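import Mathlib
import Summits.QuantumAdvantage.QuantumAdvantage.Theses.SelmerBand
import Summits.QuantumAdvantage.QuantumAdvantage.Theorems.SelmerBandBandGlue
import HarnessLib

/-!
# Route `SelmerBand`: the support `BandUpper` (stmt-QuantumAdvantage-17072) — the Cauchy–Schwarz half of the band

`BandUpper`: if eventually `Avg_{H<X} #Sel₂ ≥ 3 − ε` (the liminf half of Bhargava–Shankar Thm 1.1)
and `limsup Avg_{H<X} #Sel₂² ≤ 15` (Bhargava–Shankar–Swaminathan, second moment), then the curves with
`¬ #Sel₂ ≤ 2` have lower density `≥ 1/15`.  Proof (finite sums): with `χ = 𝟙[¬ #Sel₂ ≤ 2]` and `q_X`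
its proportion, pointwise `#Sel₂ ≤ #Sel₂·χ + 2`, so `Avg(#Sel₂ χ) ≥ 1 − ε`; Cauchy–Schwarz
(`Finset.sum_mul_sq_le_sq_mul_sq`) gives `Avg(#Sel₂ χ)² ≤ Avg(#Sel₂²)·q_X ≤ (15 + ε) q_X`; hence
`q_X ≥ (1 − ε)²/(15 + ε) ≥ 1/15 − ε`.

* `card_selmerTwo_le_indicator_add_two` — the pointwise input;
* `bandUpper_proof` — the item, by name (axioms standard; both antecedents stay hypotheses — they are
  the route's named-fact-type supports `AverageGE`, `SecondMomentLE`).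

HONEST FRAMING: a closed support item of a sibling route, NOT summit progress.

## References
* M. Bhargava, A. Shankar, Ann. of Math. 181 (2015), Thm 1.1 (arXiv:1006.1002).
* M. Bhargava, A. Shankar, A. Swaminathan, *The second moment of the size of the 2-Selmer group of
  elliptic curves*, arXiv:2110.09063, Thm 1.1.
-/

set_option linter.dupNamespace false -- D-0017: single-problem summit ⇒ `QuantumAdvantage.QuantumAdvantage` by design

namespace Summit.QuantumAdvantage.QuantumAdvantage.Theorems.SelmerBand

open Literature.NumberTheory.EllipticCurves Filter

/-- Pointwise Cauchy–Schwarz input: `#Sel₂ ≤ #Sel₂·𝟙[¬ #Sel₂ ≤ 2] + 2`. [folklore] -/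
theorem card_selmerTwo_le_indicator_add_two (AB : ℤ × ℤ) :
    (Nat.card ((shortWeierstrass AB).selmerGroup 2) : ℝ) ≤
      (Nat.card ((shortWeierstrass AB).selmerGroup 2) : ℝ) *
        (if ¬ Nat.card ((shortWeierstrass AB).selmerGroup 2) ≤ 2 then 1 else 0) + 2 := by
  by_cases h : Nat.card ((shortWeierstrass AB).selmerGroup 2) ≤ 2
  · have h2 : (Nat.card ((shortWeierstrass AB).selmerGroup 2) : ℝ) ≤ 2 := by exact_mod_cast h
    simp only [h, not_true_eq_false, ↓reduceIte, mul_zero, zero_add]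
    exact h2
  · simp only [h, not_false_eq_true, ↓reduceIte, mul_one, le_add_iff_nonneg_right]
    norm_num

/-! ### `BandUpper` (stmt-QuantumAdvantage-17072) -/

/-- **`SelmerBand.BandUpper`** (the Cauchy–Schwarz half): if eventually `Avg #Sel₂ ≥ 3 − ε` and
`limsup Avg #Sel₂² ≤ 15`, then `{¬ #Sel₂ ≤ 2}` has lower density `≥ 1/15`: with `q_X` its proportion,
`Avg(#Sel₂·𝟙) ≥ Avg #Sel₂ − 2 ≥ 1 − ε` and `Avg(#Sel₂·𝟙)² ≤ Avg(#Sel₂²)·q_X ≤ (15 + ε) q_X`, so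
`q_X ≥ (1 − ε)²/(15 + ε) ≥ 1/15 − ε`. [cite: BhargavaShankarSwaminathan2021, Thm 1.1] [folklore] -/
theorem bandUpper_proof : Summit.QuantumAdvantage.QuantumAdvantage.Theses.SelmerBand.BandUpper := by
  intro hge hsq ε hε
  -- work with δ = min ε 1/2
  set δ : ℝ := min ε (1 / 2) with hδ
  have hδpos : 0 < δ := lt_min hε (by norm_num)
  have hδε : δ ≤ ε := min_le_left _ _
  have hδ2 : δ ≤ 1 / 2 := min_le_right _ _
  have h1 := hge δ hδpos
  have h2 := hsq δ hδpos
  filter_upwards [h1, h2, eventually_ge_atTop 5] with X hX1 hX2 hX5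
  have hcard := card_heightFamilyBelow_pos hX5
  have hc : (0 : ℝ) < ((heightFamilyBelow X).card : ℝ) := by exact_mod_cast hcard
  unfold heightAverage at hX1 hX2
  unfold heightProportion heightAverage
  dsimp only at hX1 hX2 ⊢
  rw [le_div_iff₀ hc] at hX1 ⊢
  rw [div_le_iff₀ hc] at hX2
  -- the indicator χ = 𝟙[¬ #Sel₂ ≤ 2] takes values in {0, 1}
  have hχsq : ∀ AB : ℤ × ℤ,
      (if ¬ Nat.card ((shortWeierstrass AB).selmerGroup 2) ≤ 2 then (1 : ℝ) else 0) ^ 2 =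
        (if ¬ Nat.card ((shortWeierstrass AB).selmerGroup 2) ≤ 2 then (1 : ℝ) else 0) := fun AB => by
    split_ifs <;> norm_num
  have hχnn : ∀ AB : ℤ × ℤ,
      0 ≤ (if ¬ Nat.card ((shortWeierstrass AB).selmerGroup 2) ≤ 2 then (1 : ℝ) else 0) := fun AB => by
    split_ifs <;> norm_num
  -- T := Σ s χ ≥ Σ s − 2N
  have hS3 : ∑ AB ∈ heightFamilyBelow X, (Nat.card ((shortWeierstrass AB).selmerGroup 2) : ℝ) ≤
      (∑ AB ∈ heightFamilyBelow X, (Nat.card ((shortWeierstrass AB).selmerGroup 2) : ℝ) *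
        (if ¬ Nat.card ((shortWeierstrass AB).selmerGroup 2) ≤ 2 then (1 : ℝ) else 0)) +
        2 * ((heightFamilyBelow X).card : ℝ) := by
    calc ∑ AB ∈ heightFamilyBelow X, (Nat.card ((shortWeierstrass AB).selmerGroup 2) : ℝ)
        ≤ ∑ AB ∈ heightFamilyBelow X, ((Nat.card ((shortWeierstrass AB).selmerGroup 2) : ℝ) *
            (if ¬ Nat.card ((shortWeierstrass AB).selmerGroup 2) ≤ 2 then (1 : ℝ) else 0) + 2) :=
          Finset.sum_le_sum fun AB _ => card_selmerTwo_le_indicator_add_two AB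
      _ = (∑ AB ∈ heightFamilyBelow X, (Nat.card ((shortWeierstrass AB).selmerGroup 2) : ℝ) *
            (if ¬ Nat.card ((shortWeierstrass AB).selmerGroup 2) ≤ 2 then (1 : ℝ) else 0)) +
            ∑ _AB ∈ heightFamilyBelow X, (2 : ℝ) := Finset.sum_add_distrib
      _ = _ := by rw [Finset.sum_const, nsmul_eq_mul, mul_comm]
  -- Cauchy–Schwarz: (Σ s χ)² ≤ (Σ s²)(Σ χ²) = (Σ s²)(Σ χ)
  have hCS : (∑ AB ∈ heightFamilyBelow X, (Nat.card ((shortWeierstrass AB).selmerGroup 2) : ℝ) *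
        (if ¬ Nat.card ((shortWeierstrass AB).selmerGroup 2) ≤ 2 then (1 : ℝ) else 0)) ^ 2 ≤
      (∑ AB ∈ heightFamilyBelow X, (Nat.card ((shortWeierstrass AB).selmerGroup 2) : ℝ) ^ 2) *
        ∑ AB ∈ heightFamilyBelow X,
          (if ¬ Nat.card ((shortWeierstrass AB).selmerGroup 2) ≤ 2 then (1 : ℝ) else 0) := by
    have h := Finset.sum_mul_sq_le_sq_mul_sq (heightFamilyBelow X)
      (fun AB : ℤ × ℤ => (Nat.card ((shortWeierstrass AB).selmerGroup 2) : ℝ))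
      (fun AB : ℤ × ℤ => if ¬ Nat.card ((shortWeierstrass AB).selmerGroup 2) ≤ 2 then (1 : ℝ) else 0)
    simp only [hχsq] at h
    exact h
  -- abbreviate
  generalize hN : ((heightFamilyBelow X).card : ℝ) = N at *
  generalize hS : ∑ AB ∈ heightFamilyBelow X, (Nat.card ((shortWeierstrass AB).selmerGroup 2) : ℝ) = S at *
  generalize hS₂ : ∑ AB ∈ heightFamilyBelow X,
    (Nat.card ((shortWeierstrass AB).selmerGroup 2) : ℝ) ^ 2 = S₂ at *
  generalize hT : ∑ AB ∈ heightFamilyBelow X, (Nat.card ((shortWeierstrass AB).selmerGroup 2) : ℝ) *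
    (if ¬ Nat.card ((shortWeierstrass AB).selmerGroup 2) ≤ 2 then (1 : ℝ) else 0) = T at *
  have hQ0 : 0 ≤ ∑ AB ∈ heightFamilyBelow X,
      (if ¬ Nat.card ((shortWeierstrass AB).selmerGroup 2) ≤ 2 then (1 : ℝ) else 0) :=
    Finset.sum_nonneg fun AB _ => hχnn AB
  generalize hQ : ∑ AB ∈ heightFamilyBelow X,
    (if ¬ Nat.card ((shortWeierstrass AB).selmerGroup 2) ≤ 2 then (1 : ℝ) else 0) = Q at *
  -- combine: T ≥ (1 − δ) N ≥ 0, T² ≤ S₂ Q ≤ (15+δ) N Q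
  have hT1 : (1 - δ) * N ≤ T := by linarith
  have hT0 : 0 ≤ (1 - δ) * N := mul_nonneg (by linarith) hc.le
  have hT2 : ((1 - δ) * N) ^ 2 ≤ (15 + δ) * N * Q := by
    calc ((1 - δ) * N) ^ 2 ≤ T ^ 2 := pow_le_pow_left₀ hT0 hT1 2
      _ ≤ S₂ * Q := hCS
      _ ≤ (15 + δ) * N * Q := mul_le_mul_of_nonneg_right hX2 hQ0
  -- divide by N > 0: (1 − δ)² N ≤ (15 + δ) Q
  have hT3 : (1 - δ) ^ 2 * N ≤ (15 + δ) * Q := by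
    have : ((1 - δ) ^ 2 * N) * N ≤ ((15 + δ) * Q) * N := by nlinarith
    exact le_of_mul_le_mul_right this hc
  -- (1/15 − ε) N ≤ (1/15 − δ) N ≤ ((1−δ)²/(15+δ)) N ≤ Q
  have h15 : 0 < 15 + δ := by linarith
  have hkey : (1 / 15 - δ) * (15 + δ) ≤ (1 - δ) ^ 2 := by nlinarith
  have hfin : (1 / 15 - δ) * N ≤ Q := by
    have h' : (15 + δ) * ((1 / 15 - δ) * N) ≤ (15 + δ) * Q := by
      calc (15 + δ) * ((1 / 15 - δ) * N) = (1 / 15 - δ) * (15 + δ) * N := by ring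
        _ ≤ (1 - δ) ^ 2 * N := mul_le_mul_of_nonneg_right hkey hc.le
        _ ≤ (15 + δ) * Q := hT3
    exact le_of_mul_le_mul_left h' h15
  have hend : (1 / 15 - ε) * N ≤ Q :=
    calc (1 / 15 - ε) * N ≤ (1 / 15 - δ) * N := mul_le_mul_of_nonneg_right (by linarith) hc.le
      _ ≤ Q := hfin
  -- the goal's indicator carries the classical `Decidable` instance: same sum
  refine hend.trans (le_of_eq ?_)
  rw [← hQ]
  exact Finset.sum_congr rfl fun AB _ => by convert rfl


end Summit.QuantumAdvantage.QuantumAdvantage.Theorems.SelmerBand
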